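import Summits.PneNP.GCT.Max.KYCannotSeparatePaddedPerUpToEight
import Summits.PneNP.GCT.Max.KYCannotSeparatePaddedPerSevenFromNine
import HarnessLib
import HarnessLib.Audit

/-!
# `GCT/Max`: the plain Koszul–Young ceiling for padded permanents of size `m ≤ 8` — thresholds `m+1 (m ≤ 5), 8, 9, 11`
# (cell `pub-gct-max`, track F; theory-2 memo `FINDINGS-LT2.md` §4d; one-line sharpening of `Max/KYCannotSeparatePaddedPerUpToEight.lean` at `m = 7`
# by `Max/KYCannotSeparatePaddedPerSevenFromNine.lean`)

`Max/KYCannotSeparatePaddedPerUpToEight.lean` states the threshold `10` for `m = 7`; `Max/KYCannotSeparatePaddedPerSevenFromNine.lean` proves `9`.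
This module restates the capstone with the sharper threshold function `kyPaddedThresholdSharp` (PROVED).  Open for the instrument in Lean:
`(6,7)`, `(7,8)`, `(8,9)`, `(8,10)`, and `m ≥ 9` below `3m+2 ≤ 2n`.

HONEST FRAMING: a LOCATED NEGATIVE about ONE family of equations (plain Koszul–Young flattenings) at explicit sizes, assembled from the tree; in
every covered `(m,n)` with `n < m²/2` separation is KNOWN in print ([LandsbergManivelRessayre2013] Thm. 1.0.1); nothing here bears on other Young
flattenings, multiplicity obstructions, `dc(per_m)`, VP vs VNP or P vs NP; occurrence obstructions are ruled out in print (BIP'16). Theory-2 gen 28. [folklore]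
-/

namespace Summit.PneNP.GCT

open Literature.Computability.AlgebraicComplexity Literature.Barriers.ValiantsHypothesis

/-- The sharper proved threshold: `m+1` for `m ≤ 5`, then `8, 9, 11` for `m = 6, 7, 8` (placeholder `m+1` for `m ≥ 9`, nothing claimed there). [folklore] -/
def kyPaddedThresholdSharp (m : ℕ) : ℕ :=
  if m = 6 then 8 else if m = 7 then 9 else if m = 8 then 11 else m + 1

/-- `GCT/Max` node **KYCannotSeparatePaddedPerUpToEightSharp**: for every `m ≤ 8`, every `n ≥ kyPaddedThresholdSharp m` and every `(p,k)`,
`rank KY_{p,k}(X₀₀^{n-m}·per_m) ≤ rank KY_{p,k}(det_n)` over `ℂ`.  PROVED below from `KYCannotSeparatePaddedPerUpToEight` and, at `m = 7`,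
`KYCannotSeparatePaddedPerSevenFromNine`. [folklore] -/
def KYCannotSeparatePaddedPerUpToEightSharp : Prop :=
  ∀ (m n : ℕ) [NeZero n], m ≤ 8 → kyPaddedThresholdSharp m ≤ n → ∀ p k : ℕ,
    kyRank ℂ p k (paddedPerPoly ℂ m n) ≤ kyRank ℂ p k (detPoly (Fin n) ℂ)

/-- `KYCannotSeparatePaddedPerUpToEightSharp` holds. [folklore] -/
theorem kyCannotSeparatePaddedPerUpToEightSharp_holds : KYCannotSeparatePaddedPerUpToEightSharp := by
  intro m n _ hm hn p k
  by_cases h7 : m = 7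
  · subst h7
    have hn' : 9 ≤ n := by simpa [kyPaddedThresholdSharp] using hn
    exact kyCannotSeparatePaddedPerSevenFromNine_holds n hn' p k
  · have hn' : kyPaddedThreshold m ≤ n := by
      have h : kyPaddedThresholdSharp m = kyPaddedThreshold m := by simp [kyPaddedThresholdSharp, kyPaddedThreshold, h7]
      rw [← h]; exact hn
    exact kyCannotSeparatePaddedPerUpToEight_holds m n hm hn' p k

end Summit.PneNP.GCT
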